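import Mathlib
import Summits.Ventures.HodgeRepro2.T6A1DictHodge
import Summits.Ventures.HodgeRepro2.T6A1EigenSplit

/-!
# T6A1DictFactors — the factor identification `FactorIdent` from the factor data (host-free)

Tier-6 sub-goal A1, Layer III (owner t6-p1, gen 2; STATUS ll. 5218, 5283 (4)). `T6A1DictHodge.FactorIdent`
packages what the dictionary with Hodge types needs of the host (four `act`-stable subspaces `W i`
decomposing `H¹(B, ℂ)`, rational structures on them, Lemma A0.5 inside each `W i`, the Hodge numbers, the
rational Künneth clause); this file DERIVES all of it from the data a corner product `B = A₁ × ⋯ × A₄`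
actually carries on the host — `FactorData`: the four factor carriers `Vf i` (`H¹(A_i, ℂ)`) with the maps
`ι i : Vf i →ₗ[ℂ] V` (`pr_i^*`) whose ranges decompose `V` (`isInternal`), the `K`-equivariance of `ι i`,
the dimensions `dim V = 24`, `dim Vf i = 6` (Lemma 1.1.17), the one-dimensional eigenspaces and the
CM type of each factor (`line`, `type_spec` = the host's `CMVariety.finrank_eig` / `type_spec` with
`(A i).type = F.T i`), the Hodge decompositions `Vf i = h10f i ⊕ h01f i`, `V = h10V ⊕ h01V` (the host's
`HodgeModel.isInternal_hodgePQ` in degree 1), the `act`-stability of the Hodge pieces of the factors and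
the compatibility of `ι i` with the Hodge pieces (both instances of Voisin I §7.3.2: pull-back by a
holomorphic map is a morphism of Hodge structures — along the endomorphisms of `act_endo` and along
`pr_i`), rational structures on the factors and on `V` (Voisin I §7.1.1: `ℂ ⊗ H¹(X, ℚ) = H¹(X, ℂ)`) and the
rationality of `pr_i^*` on rational classes (the host's `IsRationalClass.pullback`). Outputs:
* `ι_injective`, `finrank_range : dim (range (ι i)) = 6` (the count `24 = Σ dim range (ι i) ≤ 4 · 6`);
* `eig_h10` / `eig_h01` — Lemma A0.5 inside each factor, the `(0,1)`-half by `eigSub_le_of_isCompl`;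
* `finrank_hodge_f` (`h^{1,0}(A_i) = h^{0,1}(A_i) = 3`, `T6A1EigenSplit`), `finrank_hodge_V`
  (`h^{1,0}(B) = h^{0,1}(B) = 12`, injective summation maps `Π h10f i → V`);
* `rs i` — the rational structure of `range (ι i)` transported from the factor (`RatStructure.transport`);
* `exists_sum_of_mem_R` — the rational Künneth clause by a `ℚ`-dimension count (`24 = 4 · 6`);
* **`factorIdent : FactorIdent F act h10V h01V (· ∈ D.rsV.R)`**. No host carrier, no display.
§8(d): uses an L-value-free non-vanishing device: NO.
-/

namespace Summit.Ventures.HodgeRepro2.T6.A1DictFactors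

open scoped TensorProduct
open A1Dict A1DictRat A1DictHodge A1EigenSplit A1EigenBasis

/-! ## 1. Generic linear algebra: independent families and summation maps -/

section generic

variable {V : Type*} [AddCommGroup V] [Module ℂ V]

/-- In an independent family of subspaces, a vanishing sum of members has vanishing members. -/
theorem eq_zero_of_sum_eq_zero {ι : Type*} [Fintype ι] {W : ι → Submodule ℂ V} (hW : iSupIndep W)
    (w : ι → V) (hw : ∀ j, w j ∈ W j) (h0 : ∑ j, w j = 0) (i : ι) : w i = 0 := by
  classical
  have hdisj := iSupIndep_def.1 hW i
  have hmem : w i ∈ ⨆ j, ⨆ (_ : j ≠ i), W j := by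
    have : w i = -∑ j ∈ Finset.univ.erase i, w j := by
      rw [← Finset.add_sum_erase _ _ (Finset.mem_univ i)] at h0
      exact eq_neg_of_add_eq_zero_left h0
    rw [this]
    refine Submodule.neg_mem _ (Submodule.sum_mem _ fun j hj => ?_)
    exact Submodule.mem_iSup_of_mem j (Submodule.mem_iSup_of_mem (Finset.ne_of_mem_erase hj) (hw j))
  exact (Submodule.disjoint_def.1 hdisj) _ (hw i) hmem

/-- The summation map `(x i)_i ↦ ∑ i, f i (x i)` of a family of linear maps with independent ranges and
injective members is injective. -/
theorem lsum_injective {ι : Type*} [Fintype ι] [DecidableEq ι] {Vf : ι → Type*}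
    [∀ i, AddCommGroup (Vf i)] [∀ i, Module ℂ (Vf i)] (f : ∀ i, Vf i →ₗ[ℂ] V)
    (hind : iSupIndep fun i => LinearMap.range (f i)) (hinj : ∀ i, Function.Injective (f i)) :
    Function.Injective (LinearMap.lsum ℂ Vf ℂ f) := by
  rw [← LinearMap.ker_eq_bot, LinearMap.ker_eq_bot']
  intro x hx
  rw [LinearMap.lsum_apply, LinearMap.sum_apply] at hx
  simp only [LinearMap.comp_apply, LinearMap.proj_apply] at hx
  funext i
  have := eq_zero_of_sum_eq_zero hind (fun j => f j (x j)) (fun j => LinearMap.mem_range_self _ _) hx i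
  exact hinj i (by rw [this, Pi.zero_apply, map_zero])

end generic

/-! ## 2. Transport of a rational structure along an equivariant equivalence -/

section transport

variable {K : Type*} [Field K] [NumberField K]
variable {V W : Type*} [AddCommGroup V] [Module ℂ V] [Module ℚ V] [IsScalarTower ℚ ℂ V]
  [AddCommGroup W] [Module ℂ W] [Module ℚ W] [IsScalarTower ℚ ℂ W]

/-- Transport of a rational structure along a `K`-equivariant `ℂ`-linear equivalence `e : V ≃ W`:
the rational classes of `W` are the images of those of `V`. -/
noncomputable def _root_.Summit.Ventures.HodgeRepro2.T6.A1DictRat.RatStructure.transport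
    {act : K →+* Module.End ℂ V} (S : RatStructure act) {act' : K →+* Module.End ℂ W}
    (e : V ≃ₗ[ℂ] W) (he : ∀ (x : K) (v : V), e (act x v) = act' x (e v)) : RatStructure act' where
  R := S.R.map (e.restrictScalars ℚ).toLinearMap
  act_mem x r hr := by
    obtain ⟨r', hr', rfl⟩ := Submodule.mem_map.1 hr
    exact Submodule.mem_map.2 ⟨act x r', S.act_mem x r' hr', he x r'⟩
  toV_bijective := by
    let eR : S.R ≃ₗ[ℚ] S.R.map (e.restrictScalars ℚ).toLinearMap :=
      Submodule.equivMapOfInjective _ (e.restrictScalars ℚ).injective S.R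
    have key : ∀ y : ℂ ⊗[ℚ] S.R, toV _ (eR.baseChange ℚ ℂ _ _ y) = e (toV S.R y) := by
      intro y
      induction y using TensorProduct.induction_on with
      | zero => simp
      | tmul c r =>
        rw [LinearEquiv.baseChange_tmul, toV_tmul, toV_tmul, map_smul]
        congr 1
      | add a b ha hb => rw [map_add, map_add, ha, hb, map_add, map_add]
    have hcomp : toV (S.R.map (e.restrictScalars ℚ).toLinearMap) =
        (e.toLinearMap ∘ₗ toV S.R) ∘ₗ (eR.baseChange ℚ ℂ _ _).symm.toLinearMap := by
      apply LinearMap.ext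
      intro z
      obtain ⟨y, rfl⟩ := (eR.baseChange ℚ ℂ _ _).surjective z
      simp only [LinearMap.comp_apply, LinearEquiv.coe_coe, LinearEquiv.symm_apply_apply]
      exact key y
    rw [hcomp, LinearMap.coe_comp, LinearMap.coe_comp, LinearEquiv.coe_coe, LinearEquiv.coe_coe]
    exact (e.bijective.comp S.toV_bijective).comp (eR.baseChange ℚ ℂ _ _).symm.bijective

omit [NumberField K] in
/-- Membership in the transported rational classes. -/
theorem _root_.Summit.Ventures.HodgeRepro2.T6.A1DictRat.RatStructure.mem_transport_iff
    {act : K →+* Module.End ℂ V} (S : RatStructure act) {act' : K →+* Module.End ℂ W}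
    (e : V ≃ₗ[ℂ] W) (he : ∀ (x : K) (v : V), e (act x v) = act' x (e v)) (w : W) :
    w ∈ (S.transport e he).R ↔ ∃ r ∈ S.R, e r = w := by
  simp only [RatStructure.transport, Submodule.mem_map, LinearEquiv.coe_coe,
    LinearEquiv.restrictScalars_apply]

end transport

/-! ## 3. The factor data and the derived `FactorIdent` -/

section factors

variable {K : Type*} [Field K] [NumberField K]
variable {V : Type*} [AddCommGroup V] [Module ℂ V] [Module ℚ V] [IsScalarTower ℚ ℂ V]
variable {Vf : Fin 4 → Type*} [∀ i, AddCommGroup (Vf i)] [∀ i, Module ℂ (Vf i)]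
  [∀ i, Module ℚ (Vf i)] [∀ i, IsScalarTower ℚ ℂ (Vf i)]

/-- THE FACTOR DATA of a corner product `B = A₁ × ⋯ × A₄`, host-free: the factor carriers `Vf i`
(`H¹(A_i, ℂ)`), the maps `ι i` (`pr_i^*`) with independent ranges spanning `V` (`H¹(B, ℂ)`), the
`K`-equivariance of `ι i` (the product action), the dimensions, the eigenlines and CM types of the factors,
the Hodge decompositions and their `act`-stability / compatibility with `ι i` (Voisin I §7.3.2), the
rational structures (Voisin I §7.1.1) and the rationality of `ι i`. -/
structure FactorData (F : FaceSetting K) (act : K →+* Module.End ℂ V) (h10V h01V : Submodule ℂ V)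
    (ι : ∀ i, Vf i →ₗ[ℂ] V) (actf : ∀ i, K →+* Module.End ℂ (Vf i))
    (h10f h01f : ∀ i, Submodule ℂ (Vf i)) where
  /-- `H¹(B) = ⊕_i pr_i^* H¹(A_i)` -/
  isInternal : DirectSum.IsInternal fun i => LinearMap.range (ι i)
  /-- `pr_i^*` is `K`-equivariant (the product action) -/
  ι_act : ∀ (i : Fin 4) (x : K) (v : Vf i), act x (ι i v) = ι i (actf i x v)
  /-- `dim H¹(B) = 2 · 12` -/
  finrank_V : Module.finrank ℂ V = 24
  /-- `dim H¹(A_i) = 2 · 3` -/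
  finrank_Vf : ∀ i, Module.finrank ℂ (Vf i) = 6
  /-- every eigenspace of a factor is a line -/
  line : ∀ (i : Fin 4) (τ : K →+* ℂ), Module.finrank ℂ (eigSub (actf i) τ) = 1
  /-- `H¹(A_i) = H^{1,0} ⊕ H^{0,1}` -/
  compl_f : ∀ i, IsCompl (h10f i) (h01f i)
  /-- `H^{1,0}(A_i)` is `act`-stable -/
  act_h10f : ∀ (i : Fin 4) (x : K), ∀ v ∈ h10f i, actf i x v ∈ h10f i
  /-- `H^{0,1}(A_i)` is `act`-stable -/
  act_h01f : ∀ (i : Fin 4) (x : K), ∀ v ∈ h01f i, actf i x v ∈ h01f i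
  /-- the CM type of `A_i` is `T i`: the `τ`-line is of type `(1,0)` iff `τ ∈ T i` -/
  type_spec : ∀ (i : Fin 4) (τ : K →+* ℂ), eigSub (actf i) τ ≤ h10f i ↔ τ ∈ F.T i
  /-- `pr_i^*` respects type `(1,0)` -/
  ι_h10 : ∀ i, (h10f i).map (ι i) ≤ h10V
  /-- `pr_i^*` respects type `(0,1)` -/
  ι_h01 : ∀ i, (h01f i).map (ι i) ≤ h01V
  /-- `H¹(B) = H^{1,0} ⊕ H^{0,1}` -/
  compl_V : IsCompl h10V h01V
  /-- the rational structure of each factor -/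
  rsf : ∀ i, RatStructure (actf i)
  /-- the rational structure of `H¹(B)` -/
  rsV : RatStructure act
  /-- `pr_i^*` preserves rational classes -/
  ι_ratl : ∀ (i : Fin 4), ∀ r ∈ (rsf i).R, ι i r ∈ rsV.R

namespace FactorData

variable {F : FaceSetting K} {act : K →+* Module.End ℂ V} {h10V h01V : Submodule ℂ V}
  {ι : ∀ i, Vf i →ₗ[ℂ] V} {actf : ∀ i, K →+* Module.End ℂ (Vf i)} {h10f h01f : ∀ i, Submodule ℂ (Vf i)}
  (D : FactorData F act h10V h01V ι actf h10f h01f)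

/-- `#(K →+* ℂ) = 6`. -/
theorem card_embeddings (F : FaceSetting K) : Fintype.card (K →+* ℂ) = 6 := by
  rw [NumberField.Embeddings.card K ℂ, F.deg6]

include D
/-! ### 3.1 Dimensions: `dim (range (ι i)) = 6`, `ι i` injective -/

/-- `V` is finite-dimensional. -/
theorem finite_V : FiniteDimensional ℂ V :=
  Module.finite_of_finrank_pos (by rw [D.finrank_V]; norm_num)

/-- Each factor is finite-dimensional. -/
theorem finite_Vf (i : Fin 4) : FiniteDimensional ℂ (Vf i) :=
  Module.finite_of_finrank_pos (by rw [D.finrank_Vf i]; norm_num)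

/-- `dim V = Σ_i dim (range (ι i))`. -/
theorem finrank_eq_sum : Module.finrank ℂ V = ∑ i, Module.finrank ℂ (LinearMap.range (ι i)) := by
  haveI := D.finite_V
  rw [← (LinearEquiv.ofBijective (DirectSum.coeLinearMap fun i => LinearMap.range (ι i))
    D.isInternal).finrank_eq, Module.finrank_directSum]

/-- `dim (range (ι i)) = 6`. -/
theorem finrank_range (i : Fin 4) : Module.finrank ℂ (LinearMap.range (ι i)) = 6 := by
  haveI := D.finite_V
  have hle : ∀ j ∈ (Finset.univ : Finset (Fin 4)), Module.finrank ℂ (LinearMap.range (ι j)) ≤ 6 :=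
    fun j _ => by
      haveI := D.finite_Vf j
      rw [← D.finrank_Vf j]; exact LinearMap.finrank_range_le (ι j)
  have hsum : ∑ j, Module.finrank ℂ (LinearMap.range (ι j)) = ∑ _j : Fin 4, 6 := by
    rw [← D.finrank_eq_sum, D.finrank_V]
    simp only [Finset.sum_const, Finset.card_univ, Fintype.card_fin, smul_eq_mul]
  exact (Finset.sum_eq_sum_iff_of_le hle).1 hsum i (Finset.mem_univ i)

/-- `ι i` is injective. -/
theorem ι_injective (i : Fin 4) : Function.Injective (ι i) := by
  haveI := D.finite_Vf i
  rw [← LinearMap.ker_eq_bot, ← Submodule.finrank_eq_zero]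
  have := LinearMap.finrank_range_add_finrank_ker (ι i)
  rw [D.finrank_range i, D.finrank_Vf i] at this
  omega

/-- `Vf i ≃ range (ι i)`. -/
noncomputable def equivRange (i : Fin 4) : Vf i ≃ₗ[ℂ] LinearMap.range (ι i) :=
  LinearEquiv.ofInjective (ι i) (D.ι_injective i)

/-- `equivRange` is `ι i`. -/
@[simp] theorem coe_equivRange (i : Fin 4) (v : Vf i) : (D.equivRange i v : V) = ι i v := rfl

/-- The ranges are `act`-stable. -/
theorem act_range (x : K) (i : Fin 4) : ∀ v ∈ LinearMap.range (ι i), act x v ∈ LinearMap.range (ι i) := by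
  rintro _ ⟨u, rfl⟩
  exact ⟨actf i x u, (D.ι_act i x u).symm⟩

/-- `equivRange` intertwines `actf i` with the restricted action. -/
theorem equivRange_act (i : Fin 4) (x : K) (v : Vf i) :
    D.equivRange i (actf i x v) = actW act (LinearMap.range (ι i)) (D.act_range · i) x (D.equivRange i v) := by
  apply Subtype.ext
  rw [coe_equivRange, coe_actW, coe_equivRange, D.ι_act]

/-! ### 3.2 Lemma A0.5 inside each factor -/

/-- An eigenvector of `V` in `range (ι i)` comes from an eigenvector of the factor. -/
theorem mem_eigSub_of_ι {i : Fin 4} {σ : K →+* ℂ} {u : Vf i} (hu : ι i u ∈ eigSub act σ) :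
    u ∈ eigSub (actf i) σ := by
  rw [mem_eigSub] at hu ⊢
  intro x
  apply D.ι_injective i
  rw [← D.ι_act, hu x, map_smul]

/-- Lemma A0.5, `(1,0)`: a `σ`-eigenvector of `range (ι i)` with `σ ∈ T i` is of type `(1,0)`. -/
theorem eig_h10 (i : Fin 4) (σ : K →+* ℂ) (hσ : σ ∈ F.T i) :
    ∀ v ∈ LinearMap.range (ι i), v ∈ eigSub act σ → v ∈ h10V := by
  rintro _ ⟨u, rfl⟩ hu
  exact D.ι_h10 i (Submodule.mem_map_of_mem ((D.type_spec i σ).2 hσ (D.mem_eigSub_of_ι hu)))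

/-- Lemma A0.5, `(0,1)`: a `σ`-eigenvector of `range (ι i)` with `σ ∉ T i` is of type `(0,1)` — through
`T6A1EigenSplit.eigSub_le_of_isCompl`, no conjugation. -/
theorem eig_h01 (i : Fin 4) (σ : K →+* ℂ) (hσ : σ ∉ F.T i) :
    ∀ v ∈ LinearMap.range (ι i), v ∈ eigSub act σ → v ∈ h01V := by
  rintro _ ⟨u, rfl⟩ hu
  have hle : eigSub (actf i) σ ≤ h01f i :=
    eigSub_le_of_isCompl (actf i) (D.compl_f i) (D.act_h10f i) (D.act_h01f i) (D.line i σ)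
      fun h => hσ ((D.type_spec i σ).1 h)
  exact D.ι_h01 i (Submodule.mem_map_of_mem (hle (D.mem_eigSub_of_ι hu)))

/-! ### 3.3 The Hodge numbers -/

/-- `h^{1,0}(A_i) = 3` and `h^{0,1}(A_i) = 3`. -/
theorem finrank_hodge_f (i : Fin 4) :
    Module.finrank ℂ (h10f i) = 3 ∧ Module.finrank ℂ (h01f i) = 3 := by
  haveI := D.finite_Vf i
  obtain ⟨h10, h01⟩ := finrank_eq_of_eigSub_le (actf i) (D.compl_f i) (D.act_h10f i) (D.act_h01f i)
    (D.line i) (F.T i) (D.type_spec i) (by rw [D.finrank_Vf i, card_embeddings F])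
  have hT : Nat.card (F.T i) = 3 := card_cmType F.deg6 (F.face.1 i)
  refine ⟨by rw [h10, hT], ?_⟩
  rw [h01]
  classical
  rw [Nat.card_eq_fintype_card, Fintype.card_compl_set, card_embeddings F, ← Nat.card_eq_fintype_card, hT]

/-- A subspace `U` of `V` containing `ι i (P i)` for subspaces `P i` of the factors has dimension at least
`Σ_i dim (P i)` (the summation map `Π_i P i → V` is injective). -/
theorem sum_finrank_le (P : ∀ i, Submodule ℂ (Vf i)) (U : Submodule ℂ V)
    (hP : ∀ i, (P i).map (ι i) ≤ U) : ∑ i, Module.finrank ℂ (P i) ≤ Module.finrank ℂ U := by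
  classical
  haveI := D.finite_V
  haveI : ∀ i, FiniteDimensional ℂ (Vf i) := D.finite_Vf
  let f : ∀ i, P i →ₗ[ℂ] V := fun i => ι i ∘ₗ (P i).subtype
  have hind : iSupIndep fun i => LinearMap.range (f i) := by
    refine iSupIndep.mono
      ((DirectSum.isInternal_submodule_iff_iSupIndep_and_iSup_eq_top _).1 D.isInternal).1 ?_
    intro i
    rintro _ ⟨u, rfl⟩
    exact ⟨u, rfl⟩
  have hinj : Function.Injective (LinearMap.lsum ℂ (fun i => P i) ℂ f) :=
    lsum_injective f hind fun i => (D.ι_injective i).comp Subtype.val_injective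
  have hle : LinearMap.range (LinearMap.lsum ℂ (fun i => P i) ℂ f) ≤ U := by
    rintro _ ⟨x, rfl⟩
    rw [LinearMap.lsum_apply, LinearMap.sum_apply]
    simp only [LinearMap.comp_apply, LinearMap.proj_apply, f, Submodule.coe_subtype]
    exact Submodule.sum_mem _ fun i _ => hP i (Submodule.mem_map_of_mem (x i).2)
  have h := Submodule.finrank_mono hle
  rw [LinearMap.finrank_range_of_inj hinj, Module.finrank_pi_fintype] at h
  exact h

/-- `h^{1,0}(B) = 12` and `h^{0,1}(B) = 12`. -/
theorem finrank_hodge_V : Module.finrank ℂ h10V = 12 ∧ Module.finrank ℂ h01V = 12 := by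
  haveI := D.finite_V
  have h10 := D.sum_finrank_le h10f h10V D.ι_h10
  have h01 := D.sum_finrank_le h01f h01V D.ι_h01
  simp only [fun i => (D.finrank_hodge_f i).1, fun i => (D.finrank_hodge_f i).2, Finset.sum_const,
    Finset.card_univ, Fintype.card_fin, smul_eq_mul] at h10 h01
  have hsum := Submodule.finrank_add_eq_of_isCompl D.compl_V
  rw [D.finrank_V] at hsum
  omega

/-! ### 3.4 The rational structures -/

/-- The rational structure of `range (ι i)`, transported from the factor. -/
noncomputable def rs (i : Fin 4) : RatStructure (actW act (LinearMap.range (ι i)) (D.act_range · i)) :=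
  (D.rsf i).transport (D.equivRange i) (D.equivRange_act i)

/-- Membership in `(rs i).R`. -/
theorem mem_rs_iff (i : Fin 4) (w : LinearMap.range (ι i)) :
    w ∈ (D.rs i).R ↔ ∃ r ∈ (D.rsf i).R, D.equivRange i r = w :=
  RatStructure.mem_transport_iff _ _ _ w

/-- The rational classes of a factor are rational classes of `V`. -/
theorem mem_rsV_of_mem_rs (i : Fin 4) (w : LinearMap.range (ι i)) (hw : w ∈ (D.rs i).R) :
    (w : V) ∈ D.rsV.R := by
  obtain ⟨r, hr, rfl⟩ := (D.mem_rs_iff i w).1 hw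
  rw [coe_equivRange]
  exact D.ι_ratl i r hr

/-- The `ℚ`-linear summation map `Π_i R_i → V` of the factors' rational classes. -/
noncomputable def ratSum : (∀ i, (D.rsf i).R) →ₗ[ℚ] V :=
  LinearMap.lsum ℚ (fun i => (D.rsf i).R) ℚ fun i => (ι i).restrictScalars ℚ ∘ₗ (D.rsf i).R.subtype

/-- `ratSum x = ∑ i, ι i (x i)`. -/
theorem ratSum_apply (x : ∀ i, (D.rsf i).R) : D.ratSum x = ∑ i, ι i (x i) := by
  simp [ratSum]

/-- `ratSum` is injective (independent ranges, injective `ι i`). -/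
theorem ratSum_injective : Function.Injective D.ratSum := by
  rw [← LinearMap.ker_eq_bot, LinearMap.ker_eq_bot']
  intro x hx
  rw [ratSum_apply] at hx
  funext i
  have := eq_zero_of_sum_eq_zero
    ((DirectSum.isInternal_submodule_iff_iSupIndep_and_iSup_eq_top _).1 D.isInternal).1
    (fun j => ι j (x j)) (fun j => LinearMap.mem_range_self _ _) hx i
  exact Subtype.ext (D.ι_injective i (by rw [this, Pi.zero_apply, Submodule.coe_zero, map_zero]))

/-- The range of `ratSum` is exactly the rational classes of `V` (a `ℚ`-dimension count: `4 · 6 = 24`). -/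
theorem range_ratSum : LinearMap.range D.ratSum = D.rsV.R := by
  classical
  have hle : LinearMap.range D.ratSum ≤ D.rsV.R := by
    rintro _ ⟨x, rfl⟩
    rw [ratSum_apply]
    exact Submodule.sum_mem _ fun i _ => D.ι_ratl i _ (x i).2
  haveI : FiniteDimensional ℚ D.rsV.R :=
    Module.finite_of_finrank_pos (by rw [D.rsV.finrank_R, D.finrank_V]; norm_num)
  haveI : ∀ i, FiniteDimensional ℚ (D.rsf i).R := fun i =>
    Module.finite_of_finrank_pos (by rw [(D.rsf i).finrank_R, D.finrank_Vf i]; norm_num)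
  refine Submodule.eq_of_le_of_finrank_eq hle ?_
  rw [LinearMap.finrank_range_of_inj D.ratSum_injective, Module.finrank_pi_fintype, D.rsV.finrank_R,
    D.finrank_V]
  simp only [fun i => (D.rsf i).finrank_R, D.finrank_Vf, Finset.sum_const, Finset.card_univ,
    Fintype.card_fin, smul_eq_mul]

/-- THE RATIONAL KÜNNETH CLAUSE: a rational class of `V` is a sum of rational classes of the factors. -/
theorem exists_sum_of_mem_R {r : V} (hr : r ∈ D.rsV.R) :
    ∃ f : ∀ i, LinearMap.range (ι i), (∀ i, f i ∈ (D.rs i).R) ∧ r = ∑ i, (f i : V) := by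
  rw [← D.range_ratSum] at hr
  obtain ⟨x, rfl⟩ := hr
  refine ⟨fun i => D.equivRange i (x i), fun i => (D.mem_rs_iff i _).2 ⟨x i, (x i).2, rfl⟩, ?_⟩
  rw [ratSum_apply]
  simp only [coe_equivRange]

/-! ### 3.5 The factor identification -/

/-- THE `FactorIdent` OF THE FACTOR DATA, with `ratl1 := (· ∈ D.rsV.R)`. -/
noncomputable def factorIdent : FactorIdent F act h10V h01V (· ∈ D.rsV.R) where
  W i := LinearMap.range (ι i)
  isInternal := D.isInternal
  act_W x i := D.act_range x i
  rs := D.rs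
  finrank_W := D.finrank_range
  eig_h10 := D.eig_h10
  eig_h01 := D.eig_h01
  finrank_h10V := D.finrank_hodge_V.1
  finrank_h01V := D.finrank_hodge_V.2
  ratl1_mem _ hr := D.exists_sum_of_mem_R hr
  ratl1_rs := D.mem_rsV_of_mem_rs
  ratl1_add _ _ hr hs := D.rsV.R.add_mem hr hs
  ratl1_zero := D.rsV.R.zero_mem

/-- The `W i` of `factorIdent` are the ranges of the `ι i`. -/
theorem factorIdent_W (i : Fin 4) : D.factorIdent.W i = LinearMap.range (ι i) := rfl

end FactorData

end factors

end Summit.Ventures.HodgeRepro2.T6.A1DictFactors
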